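import Mathlib
import HarnessLib
import Literature.MathematicalPhysics.QuantumLattice.KohnLuttinger
import Literature.MathematicalPhysics.QuantumLattice.FermiRG.FST2Hypotheses
import Summits.HubbardSuperconductivity.HubbardSuperconductivity.Theorems.WeakCouplingBCSKlCertTPrimePHReflectionMeasure
import Summits.HubbardSuperconductivity.HubbardSuperconductivity.Theorems.WeakCouplingBCSKlCertTPrimeConvexity
import Summits.HubbardSuperconductivity.HubbardSuperconductivity.Theorems.WeakCouplingBCSKlCertTPrimeConvexityA3

/-!
# WeakCouplingBCS — KL certificate, `t′` rows: the curvature quadratic (M side + the (A3) bridge)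

On the Fermi curve `{ε_{t′} = μ}` — the hyperbola `(1 + 2t′cos k₀)(1 + 2t′cos k₁) = 1 − t′μ` — the level-set curvature numerator is a
CONCAVE QUADRATIC in `p = cos k₀ + cos k₁`: `t′²·N = 2(1 − t′μ)·Q_{t′,μ}(p)`, `Q_{t′,μ}(p) = 2t′(1 − 4t′²)p² − m p + 4t′m`, `m = 4t′² − t′μ`
(`curvNum_factor`, `klG_on_hyperbola`, `curvNum_on_fermiCurve`).  §5a M side (`4t′ < μ < 4t′ + 32|t′|(1 − 4t′²)`): `Q < 0` at every real
`p` (negative discriminant) ⇒ `N < 0` along the whole curve (`Mside_curvNum_neg`, `Mside_curvSignConstant`).  §5b the bridge to the typed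
engine hypothesis: for `v ⊥ ∇e(k)`, `(ε_x² + ε_y²)²·hessQuad e k v = (v₁ε_x − v₀ε_y)²·N(k)` (`hessQuad_tangent`) ⇒ constant sign of `N`
gives `FermiRG.HypA3` in the matching orientation (`hypA3_of_curvNum_pos`, `hypA3_neg_of_curvNum_neg`, `Mside_hypA3_neg`).  The far Γ side,
the complete chart and the scan rows are in the companion `…KlCertTPrimeCurvatureQuadraticFarGamma`.

Honest framing: statements about the one-band dispersion `squareDispersion 1 t′` and the typed hypothesis `FermiRG.HypA3` only; nothing here
asserts a Kohn–Luttinger margin at `t′ ≠ 0`, K₃, the window or superconductivity; a Kohn–Luttinger instability statement is not ODLRO and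
nothing here proves superconductivity in the Hubbard model; no `t′ ≠ 0` statement chains to the summit Statement (`squareDispersion 1 0`).

STATUS: reader file of hubbard-klscan-idea-4 ROUND 4 (card «tprime-curvature-quadratic»); the CHECKED form of this text is `r4/Sketch.lean`
(§§1–5 in one file: farm `lean check` rc 0 · 0 err · 0 warn · 0 sorry, `#print axioms convexityChart` = propext · Classical.choice · Quot.sound);
this module elaborates once its imports (`…KlCertTPrimeConvexity`, `…KlCertTPrimeConvexityA3`) are in the tree. Filing (R286): `--supports
stmt-HubbardSuperconductivity-0158 --as helper`.

References: J. González, F. Guinea, M. A. H. Vozmediano, Phys. Rev. Lett. 79 (1997) 3514 and Int. J. Mod. Phys. B 13 (1999)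
(doi:10.1142/s0217979299002526); S. Fratini, F. Guinea, Phys. Rev. B 66 (2002) 125104, App. A; J. Feldman, M. Salmhofer, E. Trubowitz,
Comm. Pure Appl. Math. 52 (1999) 273, hypothesis (A3) (tree: `FermiRG.FST2Hypotheses`).
-/

noncomputable section

-- the tree's namespace `Summit.<Summit>.<Problem>.Theorems` repeats the summit name by design (D-0017)
set_option linter.dupNamespace false

namespace Summit.HubbardSuperconductivity.HubbardSuperconductivity.Theorems.KlTPrimeConvexity

open Real Set Literature.MathematicalPhysics.QuantumLattice

/-! ### §5  (round 4) The curvature quadratic — on the Fermi curve `t′²·N = 2(1 − t′μ)·Q_{t′,μ}(cos k₀ + cos k₁)`; the COMPLETE chart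

The separable identity of §1 makes the Fermi curve `{ε_{t′} = μ}` the HYPERBOLA `(1 + 2t′c)(1 + 2t′d) = 1 − t′μ` in the
coordinates `(c, d) = (cos k₀, cos k₁) ∈ [−1, 1]²`, and the curvature numerator FACTORS,
`N_{t′}(k) = 8 (1 + 2t′c)(1 + 2t′d) · G_{t′}(c, d)`, `G_{t′}(c, d) = (c + 2t′)(1 − d²) + (d + 2t′)(1 − c²)` (a symmetric cubic).
Restricted to the hyperbola, `4t′² G_{t′}` is a QUADRATIC in the single variable `p = c + d = −ε₀(k)/2` (the nearest-neighbour
energy along the curve): `Q_{t′,μ}(p) = 2t′(1 − 4t′²) p² − m p + 4t′ m` with `m = 4t′² − t′μ = |t′|(μ − 4t′)` the signed van Hove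
distance.  For `t′ < 0` it is CONCAVE, so on every Fermi curve `{N > 0}` is an interval in `cos k₀ + cos k₁`, and the chart is read
off: M side (`μ > 4t′`): `Q < 0` identically (negative discriminant) ⇒ constant sign and FST II (A3) in the hole orientation;
far Γ side (`μ < μ_c(t′)`): `Q > 0` between the axis value and the diagonal value of `p` ⇒ constant sign and (A3) in the electron
orientation; in between, §3's inflection.  Together with §3: **inflection ⟺ `μ_c(t′) < μ < 4t′`** (for the levels met by the scan). -/

/-- The symmetric cubic `G_{t′}(c, d) = (c + 2t′)(1 − d²) + (d + 2t′)(1 − c²)`. [folklore] -/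
def klG (tp c d : ℝ) : ℝ := (c + 2 * tp) * (1 - d ^ 2) + (d + 2 * tp) * (1 - c ^ 2)

/-- **Factorisation of the curvature numerator**: `N_{t′}(x, y) = 8 (1 + 2t′cos x)(1 + 2t′cos y) · G_{t′}(cos x, cos y)`. [folklore] -/
theorem curvNum_factor (tp x y : ℝ) :
    curvNum tp x y = 8 * ((1 + 2 * tp * cos x) * (1 + 2 * tp * cos y)) * klG tp (cos x) (cos y) := by
  have hx := sin_sq_add_cos_sq x
  have hy := sin_sq_add_cos_sq y
  simp only [curvNum, dx, dy, dxx, dyy, dxy, klG]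
  linear_combination
    (8 * (1 + 2 * tp * cos x) * (1 + 2 * tp * cos y) * (2 * (2 * tp) * sin y ^ 2 + cos y * (1 + 2 * tp * cos y))) * hx
    + (8 * (1 + 2 * tp * cos x) * (1 + 2 * tp * cos y) *
        (cos x * (1 + 2 * tp * cos x) + 2 * (2 * tp) * (1 - cos x ^ 2))) * hy

/-- The signed van Hove distance `m = 4t′² − t′μ` (`= |t′|(μ − 4t′)` for `t′ < 0`; `m > 0` M side, `m < 0` Γ side). [folklore] -/
def klM (tp μ : ℝ) : ℝ := 4 * tp ^ 2 - tp * μ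

/-- The curvature quadratic `Q_{t′,μ}(p) = 2t′(1 − 4t′²) p² − m p + 4t′ m`. [folklore] -/
def klQ (tp μ p : ℝ) : ℝ := 2 * tp * (1 - 4 * tp ^ 2) * p ^ 2 - klM tp μ * p + 4 * tp * klM tp μ

/-- On the hyperbola `(1 + 2t′c)(1 + 2t′d) = 1 − t′μ`: `4t′² G_{t′}(c, d) = Q_{t′,μ}(c + d)`. [folklore] -/
theorem klG_on_hyperbola {tp μ c d : ℝ} (h : (1 + 2 * tp * c) * (1 + 2 * tp * d) = 1 - tp * μ) :
    4 * tp ^ 2 * klG tp c d = klQ tp μ (c + d) := by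
  simp only [klG, klQ, klM]
  linear_combination (4 * tp - (c + d)) * h

/-- The Fermi curve in `(cos k₀, cos k₁)` coordinates is the hyperbola `(1 + 2t′c)(1 + 2t′d) = 1 − t′μ` (§1). [folklore] -/
theorem hyperbola_of_level {tp μ : ℝ} {k : Momentum} (hε : squareDispersion 1 tp k = μ) :
    (1 + 2 * tp * cos (k 0)) * (1 + 2 * tp * cos (k 1)) = 1 - tp * μ := by
  rw [← one_sub_tp_mul_squareDispersion, hε]

/-- `0 < 1 − t′μ` on a nonempty Fermi curve (`|t′| < 1/2`). [folklore] -/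
theorem one_sub_tp_mul_level_pos {tp μ : ℝ} (htp : |tp| < 1 / 2) {k : Momentum}
    (hε : squareDispersion 1 tp k = μ) : 0 < 1 - tp * μ := by
  rw [← hyperbola_of_level hε]
  exact mul_pos (one_add_two_tp_cos_pos htp _) (one_add_two_tp_cos_pos htp _)

/-- **CURVATURE ON THE FERMI CURVE IS A QUADRATIC IN `cos k₀ + cos k₁`**:
`t′² · N_{t′}(k) = 2 (1 − t′μ) · Q_{t′,μ}(cos k₀ + cos k₁)` whenever `ε_{t′}(k) = μ`. [folklore] -/
theorem curvNum_on_fermiCurve {tp μ : ℝ} {k : Momentum} (hε : squareDispersion 1 tp k = μ) :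
    tp ^ 2 * curvNum tp (k 0) (k 1) = 2 * (1 - tp * μ) * klQ tp μ (cos (k 0) + cos (k 1)) := by
  have hΛ := hyperbola_of_level hε
  have hG := klG_on_hyperbola hΛ
  rw [curvNum_factor]
  linear_combination (2 * (1 - tp * μ)) * hG + (8 * tp ^ 2 * klG tp (cos (k 0)) (cos (k 1))) * hΛ

/-- `μ_c(t′) < 4t′` for `−1/2 < t′ < 0`: the inflection band is a nonempty interval below the van Hove level. [folklore] -/
theorem convexityReturnLevel_lt_vanHove {tp : ℝ} (htp1 : -1 / 2 < tp) (htp0 : tp < 0) :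
    convexityReturnLevel tp < 4 * tp := by
  unfold convexityReturnLevel
  have h14 : 0 < 1 - 4 * tp ^ 2 := by nlinarith
  nlinarith [mul_neg_of_neg_of_pos htp0 h14]

/-! #### §5a  M side: negative discriminant -/

/-- M side (`4t′ < μ < 4t′ + 32|t′|(1 − 4t′²)`): the curvature quadratic is negative at EVERY real `p`. [folklore] -/
theorem klQ_neg_of_Mside {tp μ : ℝ} (htp1 : -1 / 2 < tp) (htp0 : tp < 0) (hvh : 4 * tp < μ)
    (hdisc : μ - 4 * tp < 32 * |tp| * (1 - 4 * tp ^ 2)) (p : ℝ) : klQ tp μ p < 0 := by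
  rw [abs_of_neg htp0] at hdisc
  have h14 : 0 < 1 - 4 * tp ^ 2 := by nlinarith
  have hA : 2 * tp * (1 - 4 * tp ^ 2) < 0 := by nlinarith [mul_neg_of_neg_of_pos htp0 h14]
  have hm : 0 < klM tp μ := by
    unfold klM; nlinarith [mul_pos (neg_pos.mpr htp0) (sub_pos.mpr hvh)]
  have hmK : klM tp μ < 32 * tp ^ 2 * (1 - 4 * tp ^ 2) := by
    unfold klM
    nlinarith [mul_lt_mul_of_pos_left hdisc (neg_pos.mpr htp0)]
  have hid : 4 * (2 * tp * (1 - 4 * tp ^ 2)) * klQ tp μ p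
      = (2 * (2 * tp * (1 - 4 * tp ^ 2)) * p - klM tp μ) ^ 2
        + klM tp μ * (32 * tp ^ 2 * (1 - 4 * tp ^ 2) - klM tp μ) := by
    unfold klQ; ring
  have hpos : 0 < 4 * (2 * tp * (1 - 4 * tp ^ 2)) * klQ tp μ p := by
    rw [hid]
    nlinarith [sq_nonneg (2 * (2 * tp * (1 - 4 * tp ^ 2)) * p - klM tp μ), mul_pos hm (sub_pos.mpr hmK)]
  by_contra hQ
  rw [not_lt] at hQ
  have := mul_nonneg (neg_nonneg.mpr hA.le) hQ
  linarith

/-- **M-SIDE CONVEXITY.** For `−1/2 < t′ < 0` and `4t′ < μ < 4t′ + 32|t′|(1 − 4t′²)` (every M-side cell of KL-MARGIN-SCAN) the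
curvature numerator is NEGATIVE at every point of the Fermi curve `{ε_{t′} = μ}` (in particular the curve has no critical point). [folklore] -/
theorem Mside_curvNum_neg {tp μ : ℝ} (htp1 : -1 / 2 < tp) (htp0 : tp < 0) (hvh : 4 * tp < μ)
    (hdisc : μ - 4 * tp < 32 * |tp| * (1 - 4 * tp ^ 2)) {k : Momentum}
    (hε : squareDispersion 1 tp k = μ) : curvNum tp (k 0) (k 1) < 0 := by
  have htp : |tp| < 1 / 2 := abs_lt.mpr ⟨by linarith, by linarith⟩
  have hΛ := one_sub_tp_mul_level_pos htp hε
  have hQ := klQ_neg_of_Mside htp1 htp0 hvh hdisc (cos (k 0) + cos (k 1))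
  have h := curvNum_on_fermiCurve hε
  have htp2 : 0 < tp ^ 2 := lt_of_le_of_ne (sq_nonneg tp) (Ne.symm (pow_ne_zero 2 htp0.ne))
  have hneg : 2 * (1 - tp * μ) * klQ tp μ (cos (k 0) + cos (k 1)) < 0 :=
    mul_neg_of_pos_of_neg (mul_pos two_pos hΛ) hQ
  by_contra hN
  rw [not_lt] at hN
  have := mul_nonneg htp2.le hN
  linarith

/-- M side ⇒ the typed side condition `KLCurvSignConstantTP` (constant NEGATIVE sign along the Fermi curve). [folklore] -/
theorem Mside_curvSignConstant {tp μ : ℝ} (htp1 : -1 / 2 < tp) (htp0 : tp < 0) (hvh : 4 * tp < μ)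
    (hdisc : μ - 4 * tp < 32 * |tp| * (1 - 4 * tp ^ 2)) : KLCurvSignConstantTP tp μ :=
  Or.inr fun _ hk => Mside_curvNum_neg htp1 htp0 hvh hdisc hk.2

/-! #### §5b  From the curvature sign to FST II (A3): the quadratic form on the tangent line -/

/-- Restriction of FST's quadratic form to the tangent line: for `v ⊥ ∇e(k)`,
`(ε_x² + ε_y²)² · hessQuad e k v = (v₁ε_x − v₀ε_y)² · N(k)` (`e = ε_{t′} − μ`). [folklore] -/
theorem hessQuad_tangent {tp μ : ℝ} {k v : Momentum}
    (horth : inner ℝ (gradient (fun q : Momentum => squareDispersion 1 tp q - μ) k) v = 0) :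
    (dx tp (k 0) (k 1) ^ 2 + dy tp (k 0) (k 1) ^ 2) ^ 2 *
        FermiRG.hessQuad (fun q : Momentum => squareDispersion 1 tp q - μ) k v
      = (v 1 * dx tp (k 0) (k 1) - v 0 * dy tp (k 0) (k 1)) ^ 2 * curvNum tp (k 0) (k 1) := by
  rw [klcc_inner_gradient_e] at horth
  rw [klcc_hessQuad_e]
  simp only [curvNum]
  set ex := dx tp (k 0) (k 1)
  set ey := dy tp (k 0) (k 1)
  set exx := dxx tp (k 0) (k 1)
  set exy := dxy tp (k 0) (k 1)
  set eyy := dyy tp (k 0) (k 1)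
  linear_combination
    (2 * (v 1 * ex - v 0 * ey) * (-exx * ey * ex + exy * (ex ^ 2 - ey ^ 2) + eyy * ex * ey)
      + (ex * v 0 + ey * v 1) * (exx * ex ^ 2 + 2 * exy * ex * ey + eyy * ey ^ 2)) * horth

/-- At a point with `N ≠ 0` the gradient does not vanish: `0 < ε_x² + ε_y²`. [folklore] -/
theorem gradSq_pos_of_curvNum_ne_zero {tp x y : ℝ} (h : curvNum tp x y ≠ 0) :
    0 < dx tp x y ^ 2 + dy tp x y ^ 2 := by
  by_contra hle
  rw [not_lt] at hle
  have hx2 : dx tp x y * dx tp x y = 0 := by nlinarith [sq_nonneg (dx tp x y), sq_nonneg (dy tp x y)]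
  have hy2 : dy tp x y * dy tp x y = 0 := by nlinarith [sq_nonneg (dx tp x y), sq_nonneg (dy tp x y)]
  have hx := mul_self_eq_zero.mp hx2
  have hy := mul_self_eq_zero.mp hy2
  apply h
  simp [curvNum, hx, hy]

/-- A nonzero tangent vector has a nonzero coefficient along `(−ε_y, ε_x)` (regular point). [folklore] -/
theorem tangentCoeff_ne_zero {tp μ : ℝ} {k v : Momentum} (hv : v ≠ 0)
    (horth : inner ℝ (gradient (fun q : Momentum => squareDispersion 1 tp q - μ) k) v = 0)
    (hD : 0 < dx tp (k 0) (k 1) ^ 2 + dy tp (k 0) (k 1) ^ 2) :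
    v 1 * dx tp (k 0) (k 1) - v 0 * dy tp (k 0) (k 1) ≠ 0 := by
  intro hL0
  rw [klcc_inner_gradient_e] at horth
  have h0 : v 0 * (dx tp (k 0) (k 1) ^ 2 + dy tp (k 0) (k 1) ^ 2) = 0 := by
    linear_combination dx tp (k 0) (k 1) * horth - dy tp (k 0) (k 1) * hL0
  have h1 : v 1 * (dx tp (k 0) (k 1) ^ 2 + dy tp (k 0) (k 1) ^ 2) = 0 := by
    linear_combination dy tp (k 0) (k 1) * horth + dx tp (k 0) (k 1) * hL0
  have hv0 : v 0 = 0 := by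
    rcases mul_eq_zero.mp h0 with h | h
    · exact h
    · exact absurd h hD.ne'
  have hv1 : v 1 = 0 := by
    rcases mul_eq_zero.mp h1 with h | h
    · exact h
    · exact absurd h hD.ne'
  apply hv
  refine PiLp.ext fun i => ?_
  fin_cases i
  · simpa using hv0
  · simpa using hv1

/-- (A3) from a POSITIVE curvature numerator along the whole Fermi curve (electron orientation `e = ε_{t′} − μ`). [folklore] -/
theorem hypA3_of_curvNum_pos {tp μ : ℝ}
    (hpos : ∀ k : Momentum, squareDispersion 1 tp k = μ → 0 < curvNum tp (k 0) (k 1)) :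
    FermiRG.HypA3 (fun q : Momentum => squareDispersion 1 tp q - μ) := by
  intro k hk v hv horth
  have hε : squareDispersion 1 tp k = μ := by
    rw [FermiRG.mem_fermiSurface] at hk
    linarith
  have hN := hpos k hε
  have htan := hessQuad_tangent horth
  have hD := gradSq_pos_of_curvNum_ne_zero hN.ne'
  have hL := tangentCoeff_ne_zero hv horth hD
  have hL2 : 0 < (v 1 * dx tp (k 0) (k 1) - v 0 * dy tp (k 0) (k 1)) ^ 2 :=
    lt_of_le_of_ne (sq_nonneg _) (Ne.symm (pow_ne_zero 2 hL))
  have hD2 : 0 < (dx tp (k 0) (k 1) ^ 2 + dy tp (k 0) (k 1) ^ 2) ^ 2 := by positivity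
  by_contra hH
  rw [not_lt] at hH
  have h1 := mul_pos hL2 hN
  have h2 := mul_nonneg hD2.le (neg_nonneg.mpr hH)
  linarith

/-- (A3) from a NEGATIVE curvature numerator along the whole Fermi curve (hole orientation `e = μ − ε_{t′}`). [folklore] -/
theorem hypA3_neg_of_curvNum_neg {tp μ : ℝ}
    (hneg : ∀ k : Momentum, squareDispersion 1 tp k = μ → curvNum tp (k 0) (k 1) < 0) :
    FermiRG.HypA3 (fun q : Momentum => -(squareDispersion 1 tp q - μ)) := by
  intro k hk v hv horth
  have hε : squareDispersion 1 tp k = μ := by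
    rw [FermiRG.mem_fermiSurface] at hk
    linarith
  have hN := hneg k hε
  have hfun : (fun q : Momentum => -(squareDispersion 1 tp q - μ))
      = -(fun q : Momentum => squareDispersion 1 tp q - μ) := rfl
  have horth' : inner ℝ (gradient (fun q : Momentum => squareDispersion 1 tp q - μ) k) v = 0 := by
    have h := horth
    rw [hfun] at h
    unfold gradient at h ⊢
    rw [fderiv_neg, map_neg, inner_neg_left, neg_eq_zero] at h
    exact h
  have hH : FermiRG.hessQuad (fun q : Momentum => -(squareDispersion 1 tp q - μ)) k v
      = -FermiRG.hessQuad (fun q : Momentum => squareDispersion 1 tp q - μ) k v := by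
    rw [FermiRG.hessQuad, FermiRG.hessQuad, hfun, iteratedFDeriv_neg_apply, neg_apply]
  have htan := hessQuad_tangent horth'
  have hD := gradSq_pos_of_curvNum_ne_zero hN.ne
  have hL := tangentCoeff_ne_zero hv horth' hD
  have hL2 : 0 < (v 1 * dx tp (k 0) (k 1) - v 0 * dy tp (k 0) (k 1)) ^ 2 :=
    lt_of_le_of_ne (sq_nonneg _) (Ne.symm (pow_ne_zero 2 hL))
  have hD2 : 0 < (dx tp (k 0) (k 1) ^ 2 + dy tp (k 0) (k 1) ^ 2) ^ 2 := by positivity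
  rw [hH]
  by_contra hH'
  rw [not_lt] at hH'
  have h1 := mul_neg_of_pos_of_neg hL2 hN
  have h2 := mul_nonneg hD2.le (neg_nonpos.mp hH')
  linarith

/-- **M-SIDE FERMI-LIQUID ELIGIBILITY**: on every M-side cell FST II (A3) HOLDS in the hole orientation `e = μ − ε_{t′}`
(the typed strict-convexity hypothesis of `Literature…FermiRG.FST2Hypotheses`; §3c showed it FAILS in both orientations on the
inflection band). [folklore] -/
theorem Mside_hypA3_neg {tp μ : ℝ} (htp1 : -1 / 2 < tp) (htp0 : tp < 0) (hvh : 4 * tp < μ)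
    (hdisc : μ - 4 * tp < 32 * |tp| * (1 - 4 * tp ^ 2)) :
    FermiRG.HypA3 (fun q : Momentum => -(squareDispersion 1 tp q - μ)) :=
  hypA3_neg_of_curvNum_neg fun _ hε => Mside_curvNum_neg htp1 htp0 hvh hdisc hε

end Summit.HubbardSuperconductivity.HubbardSuperconductivity.Theorems.KlTPrimeConvexity

end
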